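import Literature.AnabelianGeometry.EtaleTheta.ArithThetaTowerFrobenioidLawsOf
import Literature.AnabelianGeometry.EtaleTheta.ArithThetaTowerNonDilating
import Literature.AnabelianGeometry.EtaleTheta.ArithThetaTowerDivisorMonoidsLaws
import Literature.AnabelianGeometry.EtaleTheta.ArithThetaTowerConstTowerOfGaloisValDatum
import HarnessLib

/-!
# [IUTchI] Ex. 3.2 (i) / [EtTh] Def. 3.6 (ii) at the ARITHMETIC theta tower: the decoupling spec S0 `CarrierSpec` and the pull
# dichotomy AT THE ENGINE TERM `temperedFrobenioidOf` (GAP A item GA-12, LAW half of D4 — file 2 of 3)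

S. Mochizuki, *The étale theta function …*, Publ. RIMS **45** (2009) [MochizukiEtTh2009], Def. 3.3 (iii) / Rmk. 3.3.1 p.73, Def. 3.6
(i)(ii) pp.76–77, §5 p.104 [cite: MochizukiEtTh2009, Def 3.6 p.77]; [Mochizuki2012] Ex. 3.2 (i)(ii) pp.69–71 [claim: Mochizuki2012, status:
disputed — nothing of the series is asserted]; [FrdI] §0 p.12 (primary, `≼`), Def. 1.1 (i) p.19; [FrdII] Ex. 1.1 (i) p.7, Thm. 1.2 (i) p.9.

GAP A of record G-L5-EX32I-1 (abc-iut cell), item **GA-12** (GAP-SIZING-A.md 69de97346848d3e8 §2 D4 LAW half; `plan/L5/GAP-A-SIGNATURES.md` v1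
e3ccddf9b87597cf §0/§4; RULINGS #319 (c1)–(c4) / #321/#322 (c2′)(c3′) / #334 (2) / #336 (1) / #339 (1)(3) / #342 (C)), seat
abc-iut-gapA-12-def36iiLawsCarrierSpec.  Binders §0.  CONSUMED BY NAME: GA-04's S0 `ArithThetaTower.CarrierSpec` (★ p667989) and ADD-ON
`CarrierSpec.PullDichotomy` / `aut_finite_holds` / `exists_deckLift` (★ p670531), GA-08's transport `CarrierSpec.pullDichotomy_of_lattice` /
`latticeDichotomy_prod_of_snd` (★ p671252), this seat's engine
term `temperedFrobenioidOf d T A hZ hZc` (★ p670142), GA-02's `divisorMonoidsOf` (★ p667325) and `constDivInclOf` / `div₀_const`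
(`ArithThetaTowerDivisorMonoidsLaws.lean`), GA-01's `GaloisValDatum.valuation_gal_eq` (★ p667500).

WHAT IS HERE (engine form, for ANY geometric `(Z, A)` with `Z.const = ⊥`):
* §1 `ordIntMapOfHom_endo_eq`: along an ENDOMORPHISM of `𝒟⊢_v̲ = CosetCat G_v̲` the restriction `ord(𝒪^▷_{Ω^V}) → ord(𝒪^▷_{Ω^V})` is the
  IDENTITY (`Gal(Ω/K_v̲)` acts by isometries, `valuation_gal_eq`); hence `divisorMonoidsOf_Φ₀_map_endo_apply`: the pull of `Φ₀(U) = ord ×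
  Div⁺(Z)^U` along `f : U → U` is `(a, φ) ↦ (a, f^*φ)`;
* §2 the S0 fields at the engine term that do not come from GA-04's add-on: `constEmbOf` (`κ : (Ω^{aug U})ˣ ↦ (u, 1) ∈ B₀(U)`, natural) and
  **`consts_realifiedOf`** (`⟨κ, constDivIncl, …⟩`: injective, natural, image in `F₀`, `Div` of a constant = its valuation — RULINGS
  #334 (2)(b) literally, constants GENUINE via `T.proj`); **`theta_realifiedOf_of_geom (hθ)`**: a geometric theta witness at `P/Π_Ÿ` (a `Π`-invariant
  function `θ` with effective CUSPIDAL zero divisor `Zr ≠ 0`, NON-CUSPIDAL pole divisor `Pl ≠ 0`, coprime, `div θ · [Pl] = [Zr]`) transported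
  through the direct sum as `((1, θ), (1, Zr), (1, Pl))` to the S0 field `theta` at `realifiedOf d T A hZ`.
* §3 AT THE ENGINE TERM: **`carrierSpec_temperedFrobenioidOf (hθ) : CarrierSpec d T (temperedFrobenioidOf d T A hZ hZc)`** (`aut_finite`/`lZ`
  by GA-04's add-on dischargers `aut_finite_holds`/`exists_deckLift`, ★ p670531, BY NAME) and **`pullDichotomy_temperedFrobenioidOf (hC) (hdich) :
  CarrierSpec.PullDichotomy (temperedFrobenioidOf d T A hZ hZc)`** — ONE TRANSPORT (keeper π4): GA-08's `CarrierSpec.pullDichotomy_of_lattice` /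
  `latticeDichotomy_prod_of_snd` (★ p671252) BY NAME, the valuation coordinate fixed by §1.  The ruled `carrierSpec_temperedFrobenioid d T` /
  `pullDichotomy_temperedFrobenioid d T` (file 3) are these at GA-10's theta envelope (`hθ :=` GA-10's `thetaSection`, `hdich :=` the U-orbit
  argument of RULINGS #339 (1)).

HONEST FRAMING: constructions/theorems over typed interfaces; `(Z, A)` a parameter; the theta witness is a HYPOTHESIS here (discharged at the
decreed envelope by GA-10's `thetaSection`, file 3); an UNDISPUTED construction around [IUTchIII] Cor. 3.12, OPEN by charter (D-0045) — no side
taken on it or on any author; NOT an abc claim; typed ≠ inhabited ≠ proved-in-print; count-neutral.  No `Prop` fact, no instance, no notation, no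
attribute, no `sorry`.
-/

noncomputable section

namespace Literature.AnabelianGeometry.EtaleTheta

namespace ArithThetaTower

open CategoryTheory Opposite Function Literature.AlgebraicGeometry.Frobenioids
  Literature.AlgebraicGeometry.Frobenioids.PadicFrd Literature.AnabelianGeometry.SemiGraphs Literature.IUT.HodgeTheaters
  LogDivisorModel LogDivisorModel.GaloisAction

variable {p : ℕ} [Fact p.Prime] (d : GaloisValDatum.{0} p)

/-! ## §1 Endomorphisms of `𝒟⊢_v̲` act trivially on `ord(𝒪^▷)` (Galois acts by isometries) -/

/-- **Along an ENDOMORPHISM `f : V → V` of `𝒟⊢_v̲ = CosetCat G_v̲` the restriction map `ord(𝒪^▷_{Ω^V}) → ord(𝒪^▷_{Ω^V})` is the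
identity**: `x ↦ g·x` for a representative `g ∈ G_v̲` of the point of `f`, and `v(g·x) = v(x)` (GA-01's `GaloisValDatum.valuation_gal_eq`; [FrdII] Thm. 1.2 (i)
«`End_D(A_D)` acts trivially on `Φ(A_D)`»). [cite: MochizukiFrdII2008, Thm 1.2 (i) p.9] -/
theorem ordIntMapOfHom_endo_eq {V : CosetCat d.Gal} (f : V ⟶ V) (a : OrdInt (d.fieldFunctor.obj V).K) :
    ordIntMapOfHom (d.fieldFunctor.map f).alg (d.fieldFunctor.map f).isValHom a = a := by
  obtain ⟨x, rfl⟩ := Associates.mk_surjective a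
  obtain ⟨g, hg⟩ := Quotient.exists_rep (CosetCat.pt f)
  rw [ordIntMapOfHom_mk, associatesMk_eq_iff_valuation_eq, ← Valuation.veq_iff_eq, ValuativeRel.veq_def,
    coe_intNonzeroMapOfHom]
  change (@ValuativeRel.vle (d.fixedFld V) _ (d.valOn _) (d.fixedHom f x.1) x.1) ∧
    @ValuativeRel.vle (d.fixedFld V) _ (d.valOn _) x.1 (d.fixedHom f x.1)
  rw [d.valOn_iff, d.valOn_iff, d.fixedHom_apply_coe f g hg.symm]
  have h := d.valuation_gal_eq g ((show ↥(d.fixedFld V) from x.1) : d.Ω)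
  rw [← Valuation.veq_iff_eq, ValuativeRel.veq_def] at h
  exact h

variable {P : Type} [Group P] [TopologicalSpace P] (T : BadLocalGroupDatum d.Gal P)
  {Z : LogDivisorModel.{0}} (A : Z.GaloisAction P) (hZ : Z.CuspLaws)

/-- **The pull of `Φ₀(U) = ord(𝒪^▷_{Ω^{aug U}}) × Hom_Π(P/U, Div⁺(Z))` along an endomorphism `f : U → U` of `𝒟_v̲` is
`(a, φ) ↦ (a, f^*φ)`**: identity on the valuation coordinate. [cite: MochizukiEtTh2009, Def 3.3 p.73] -/
theorem divisorMonoidsOf_Φ₀_map_endo_apply {U : T.Dvᵒᵖ} (f : U ⟶ U)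
    (m : ((divisorMonoidsOf d T A hZ).Φ₀.obj U : Type)) :
    ((divisorMonoidsOf d T A hZ).Φ₀.map f).hom m = (m.1, A.phiZeroPull ((cosetGSetFunctor P).map f.unop) m.2) := by
  rw [divisorMonoidsOf_Φ₀_map_apply]
  exact Prod.ext (ordIntMapOfHom_endo_eq d (T.proj.map f.unop) m.1) rfl

/-! ## §2 S0 fields at the engine term: the genuine constants and the theta witness -/

/-- **`κ` — the genuine constant tower `U ↦ (Ω^{aug U})ˣ` of `T.proj ⋙ d.fieldFunctor` EMBEDS into `B₀(U) = (Ω^{aug U})ˣ × Mero(Z)^U`**,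
`u ↦ (u, 1)`, naturally (RULINGS #321/#322 (c2′): constants through `T.proj`, NOT through `rebase`; #334 (2)(b)).
[cite: MochizukiEtTh2009, Def 3.3 p.73] -/
def constEmbOf : PadicFrd.bZeroOn (T.proj ⋙ d.fieldFunctor) ⟶ (divisorMonoidsOf d T A hZ).B₀ where
  app U := CommMonCat.ofHom (MonoidHom.inl _ _)
  naturality {U V} f := by
    apply CommMonCat.hom_ext
    ext u
    change ((((PadicFrd.bZeroOn (T.proj ⋙ d.fieldFunctor)).map f).hom u, 1) :
        ((constFld d T V.unop).K)ˣ × A.bZero ((cosetGSetFunctor P).obj V.unop)) =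
      ((divisorMonoidsOf d T A hZ).B₀.map f).hom
        ((u, 1) : ((constFld d T U.unop).K)ˣ × A.bZero ((cosetGSetFunctor P).obj U.unop))
    rw [divisorMonoidsOf_B₀_map_apply, map_one]
    rfl

/-- `κ_U u = (u, 1)`. [cite: MochizukiEtTh2009, Def 3.3 p.73] -/
@[simp] theorem constEmbOf_app_apply (U : T.Dvᵒᵖ) (u : ((constFld d T U.unop).K)ˣ) :
    ((constEmbOf d T A hZ).app U).hom u = ((u, 1) : ((constFld d T U.unop).K)ˣ × A.bZero ((cosetGSetFunctor P).obj U.unop)) := rfl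

/-- **S0 `consts` HOLDS at the engine term** (for every geometric input): `κ = constEmbOf` (injective, natural, image in `F₀ = (Ω^{aug U})ˣ × fZero`),
`ι = constDivInclOf` (GA-02, injective, natural along `ord(fixedHom)`), and `Div(κ u) = ι^gp(ι(ord u))` read through the lattice map `Φ₀ → Φ₀^ℝ`
(GA-02's `div₀_const`) — RULINGS #334 (2)(b) literally; this is the NON-VACUOUS sub-gap (a) lever (GA-13's `CdashToC`, GA-06's `constUnits`).
[cite: MochizukiEtTh2009, Def 3.6 p.77] -/
theorem consts_realifiedOf :
    ∃ (κ : PadicFrd.bZeroOn (T.proj ⋙ d.fieldFunctor) ⟶ (realifiedOf d T A hZ).BΛ)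
      (ι : ∀ Y : T.Dvᵒᵖ, PadicFrd.OrdInt (d.fieldFunctor.obj (T.proj.obj (unop Y))).K →* ((realifiedOf d T A hZ).Φ₀.obj Y : Type)),
      (∀ Y : T.Dvᵒᵖ, Injective (κ.app Y).hom) ∧ (∀ Y : T.Dvᵒᵖ, Injective (ι Y)) ∧
      (∀ (Y : T.Dvᵒᵖ) (u : ((d.fieldFunctor.obj (T.proj.obj (unop Y))).K)ˣ), (κ.app Y).hom u ∈ (realifiedOf d T A hZ).FΛ Y) ∧
      (∀ {Y Y' : T.Dvᵒᵖ} (f : Y ⟶ Y') (x : PadicFrd.OrdInt (d.fieldFunctor.obj (T.proj.obj (unop Y))).K),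
        ((realifiedOf d T A hZ).Φ₀.map f).hom (ι Y x) =
          ι Y' (PadicFrd.ordIntMapOfHom (d.fieldFunctor.map (T.proj.map f.unop)).alg
            (d.fieldFunctor.map (T.proj.map f.unop)).isValHom x)) ∧
      (∀ (Y : T.Dvᵒᵖ) (u : ((d.fieldFunctor.obj (T.proj.obj (unop Y))).K)ˣ),
        (realifiedOf d T A hZ).divΛ Y ((κ.app Y).hom u) =
          gpMap ((realifiedOf d T A hZ).toR Y) (gpMap (ι Y) (PadicFrd.divUnits (d.fieldFunctor.obj (T.proj.obj (unop Y))).K u))) := by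
  refine ⟨constEmbOf d T A hZ, fun Y => constDivInclOf d T A Y, fun Y u v h => ?_, fun Y => constDivInclOf_injective d T A Y,
    fun Y u => const_mem_F₀ d T A hZ Y u, fun f x => constDivInclOf_natural d T A hZ f x, fun Y u => ?_⟩
  · exact congrArg Prod.fst h
  · change gpMap ((realifiedOf d T A hZ).toR Y) ((divisorMonoidsOf d T A hZ).div₀ Y
        ((u, 1) : ((constFld d T Y.unop).K)ˣ × A.bZero ((cosetGSetFunctor P).obj Y.unop))) = _
    rw [div₀_const]
    rfl

/-- **S0 `theta` at the engine term from a GEOMETRIC theta witness at `P/Π_Ÿ`**: a `Π`-invariant log-meromorphic function `θ` on the covering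
`Ÿ_T` with effective CUSPIDAL `Zr ≠ 0` and NON-CUSPIDAL `Pl ≠ 0`, coprime, and `div θ · [Pl] = [Zr]` ([EtTh] Prop. 1.4 (i) / §5: zeros at the cusps,
poles along the special fibre) yields the S0 field through the direct sum as `((1, θ), (1, Zr), (1, Pl))` (`csp₀ = ⊥ × cspZero`, `ncsp₀ = ⊤ ×
ncspZero`).  The witness is a HYPOTHESIS here (GA-10's decreed `thetaSection` at the envelope discharges it, file 3). [cite: MochizukiEtTh2009, Def 3.6 p.77] -/
theorem theta_realifiedOf_of_geom
    (hθ : ∃ (θ : A.bZero ((cosetGSetFunctor P).obj T.ydd)) (Zr Pl : A.phiZero ((cosetGSetFunctor P).obj T.ydd)),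
      Zr ∈ A.cspZero _ ∧ Pl ∈ A.ncspZero _ ∧ Zr ≠ 1 ∧ Pl ≠ 1 ∧ IsRelPrime Zr Pl ∧
        A.divZeroHom _ θ * Algebra.GrothendieckGroup.of Pl = Algebra.GrothendieckGroup.of Zr) :
    ∃ (θ : ((realifiedOf d T A hZ).BΛ.obj (op T.ydd) : Type)) (Zr Pl : ((realifiedOf d T A hZ).Φ₀.obj (op T.ydd) : Type)),
      Zr ∈ (realifiedOf d T A hZ).csp₀ (op T.ydd) ∧ Pl ∈ (realifiedOf d T A hZ).ncsp₀ (op T.ydd) ∧ Zr ≠ 1 ∧ Pl ≠ 1 ∧ IsRelPrime Zr Pl ∧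
      (realifiedOf d T A hZ).divΛ (op T.ydd) θ * Algebra.GrothendieckGroup.of ((realifiedOf d T A hZ).toR (op T.ydd) Pl) =
        Algebra.GrothendieckGroup.of ((realifiedOf d T A hZ).toR (op T.ydd) Zr) := by
  obtain ⟨θ, Zr, Pl, hZr, hPl, hZr1, hPl1, hrel, hdiv⟩ := hθ
  let K := (constFld d T T.ydd).K
  let S := (cosetGSetFunctor P).obj T.ydd
  refine ⟨((1, θ) : Kˣ × A.bZero S), (((1 : OrdInt K), Zr) : ((divisorMonoidsOf d T A hZ).Φ₀.obj (op T.ydd) : Type)),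
    (((1 : OrdInt K), Pl) : ((divisorMonoidsOf d T A hZ).Φ₀.obj (op T.ydd) : Type)), ?_, ?_, ?_, ?_, ?_, ?_⟩
  · change (((1 : OrdInt K), Zr) : OrdInt K × A.phiZero S) ∈ (divisorMonoidsOf d T A hZ).csp₀ (op T.ydd)
    rw [divisorMonoidsOf_csp₀]
    exact ⟨Submonoid.one_mem _, hZr⟩
  · change (((1 : OrdInt K), Pl) : OrdInt K × A.phiZero S) ∈ (divisorMonoidsOf d T A hZ).ncsp₀ (op T.ydd)
    rw [divisorMonoidsOf_ncsp₀]
    exact ⟨Submonoid.mem_top _, hPl⟩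
  · exact fun h => hZr1 (congrArg Prod.snd h)
  · exact fun h => hPl1 (congrArg Prod.snd h)
  · rintro ⟨c₁, c₂⟩ h₁ h₂
    have h₁' := Prod.mk_dvd_mk.mp h₁
    have h₂' := Prod.mk_dvd_mk.mp h₂
    exact Prod.isUnit_iff.mpr ⟨isUnit_of_dvd_one h₁'.1, hrel h₁'.2 h₂'.2⟩
  · -- `div (1, θ) = ι₂^gp(div θ)`; apply `gpMap (Φ₀ → Φ₀^ℝ)` to `ι₂^gp(div θ) · [(1, Pl)] = [(1, Zr)]`
    have key : (divisorMonoidsOf d T A hZ).div₀ (op T.ydd) ((1, θ) : Kˣ × A.bZero S) *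
        Algebra.GrothendieckGroup.of (M := ((divisorMonoidsOf d T A hZ).Φ₀.obj (op T.ydd) : Type)) ((1 : OrdInt K), Pl) =
          Algebra.GrothendieckGroup.of (M := ((divisorMonoidsOf d T A hZ).Φ₀.obj (op T.ydd) : Type)) ((1 : OrdInt K), Zr) := by
      rw [divisorMonoidsOf_div₀_apply]
      dsimp only [Opposite.unop_op]
      rw [map_one, map_one, one_mul]
      have h := congrArg (gpMap (MonoidHom.inr (OrdInt K) (A.phiZero S))) hdiv
      rw [map_mul, EtaleTheta.gpMap_of, EtaleTheta.gpMap_of] at h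
      exact h
    have key' := congrArg
      (gpMap ((toRlfNatTransWeak (divisorMonoidsOf d T A hZ).Φ₀ (isPerfFactorial_divisorMonoidsOf d T A hZ)).app (op T.ydd)).hom) key
    rw [map_mul, EtaleTheta.gpMap_of, EtaleTheta.gpMap_of] at key'
    exact key'

/-! ## §3 S0 and the pull dichotomy AT THE ENGINE TERM -/

section Term

variable [IsTopologicalGroup P] (hZc : Z.const = ⊥)

/-- **S0 `CarrierSpec` HOLDS at the engine term `temperedFrobenioidOf d T A hZ hZc`** for every geometric input with trivial constants and
a geometric theta witness `hθ` at `P/Π_Ÿ`: `base_eq`/`Φ_carrier` by `rfl` (GA-04's `CarrierData.canonical`), `consts` genuine via `T.proj`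
(`consts_realifiedOf`), `aut_finite`/`lZ` by GA-04's add-on dischargers `aut_finite_holds`/`exists_deckLift` (★ p670531) BY NAME, `theta`
transported from `hθ` (`theta_realifiedOf_of_geom`).  The ruled `carrierSpec_temperedFrobenioid d T` (file 3) is this at GA-10's envelope,
`hθ :=` GA-10's `thetaSection`. [cite: MochizukiEtTh2009, Def 3.6 p.77] -/
theorem carrierSpec_temperedFrobenioidOf
    (hθ : ∃ (θ : A.bZero ((cosetGSetFunctor P).obj T.ydd)) (Zr Pl : A.phiZero ((cosetGSetFunctor P).obj T.ydd)),
      Zr ∈ A.cspZero _ ∧ Pl ∈ A.ncspZero _ ∧ Zr ≠ 1 ∧ Pl ≠ 1 ∧ IsRelPrime Zr Pl ∧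
        A.divZeroHom _ θ * Algebra.GrothendieckGroup.of Pl = Algebra.GrothendieckGroup.of Zr) :
    CarrierSpec d T (temperedFrobenioidOf d T A hZ hZc) where
  base_eq := rfl
  Φ_carrier _ := rfl
  consts := consts_realifiedOf d T A hZ
  aut_finite U f hU := aut_finite_holds _ U f hU
  theta := theta_realifiedOf_of_geom d T A hZ hθ
  lZ := exists_deckLift _ T.ydd

/-- **The pull dichotomy `CarrierSpec.PullDichotomy` HOLDS at the engine term** whenever the GEOMETRIC pull along every endomorphism
`f : U → U` of `𝒟_v̲` is the identity on `Hom_Π(P/U, Div⁺(Z))` or carries a primary element off itself (`hdich`; RULINGS #339 (1): at the theta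
envelope `f^*` is `e_O ↦ e_{n·O}` on the `U`-orbits, file 3).  ONE TRANSPORT (keeper π4): this seat TAKES GA-08's lattice → carrier transport
`CarrierSpec.pullDichotomy_of_lattice` (★ p671252) BY NAME, fed through GA-08's `latticeDichotomy_prod_of_snd` with the valuation coordinate
FIXED (`divisorMonoidsOf_Φ₀_map_endo_apply`, GA-01's `valuation_gal_eq`) and `ord(𝒪^▷)` sharp (`isSharp_associates`) — GA-08's recipe
`pub/abc-iut/gapA/GA-08/recipe-GA12-pullDichotomy.lean` on the nose. [cite: MochizukiFrdI2008, Def. 1.1 (i) p.19] -/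
theorem pullDichotomy_temperedFrobenioidOf (hC : CarrierSpec d T (temperedFrobenioidOf d T A hZ hZc))
    (hdich : ∀ (U : T.Dv) (f : U ⟶ U),
      (∀ φ : A.phiZero ((cosetGSetFunctor P).obj U), A.phiZeroPull ((cosetGSetFunctor P).map f) φ = φ) ∨
        ∃ φ : A.phiZero ((cosetGSetFunctor P).obj U),
          IsPrimary φ ∧ ¬ Precsim (A.phiZeroPull ((cosetGSetFunctor P).map f) φ) φ) :
    CarrierSpec.PullDichotomy (temperedFrobenioidOf d T A hZ hZc) :=
  hC.pullDichotomy_of_lattice fun U f =>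
    latticeDichotomy_prod_of_snd isSharp_associates (((divisorMonoidsOf d T A hZ).Φ₀.map f).hom)
      (A.phiZeroPull ((cosetGSetFunctor P).map f.unop)) (divisorMonoidsOf_Φ₀_map_endo_apply d T A hZ f)
      (hdich (unop U) f.unop)

end Term

end ArithThetaTower

end Literature.AnabelianGeometry.EtaleTheta

end
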